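import Mathlib
import HarnessLib
import Summits.ResolutionOfSingularities.ResolutionOfSingularities.Theorems.WildQuotientsWildQuotientResolutionToricExitCentre
import Literature.AlgebraicGeometry.Resolution.BlowupPrincipalCharts
import Literature.AlgebraicGeometry.Resolution.BlowupsEquivariant
import Literature.AlgebraicGeometry.Resolution.AffineBlowupAlgebra

/-!
# V3U-F brick `HneOb`: the stable piece `⋂ g·V[x_b²]` of `Bl_{(x_a, x_b²)} 𝔸ⁿ` is non-empty
(crux stmt-ResolutionOfSingularities-15640 `WildQuotients.WildQuotientResolution`, line `Sketch`;
chain w45c programme V3U, `L/w45c/CHAIN.md` v6 §4 lead-1 row — the brick `HneOb` of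
res-L1-w45c-lead-1's `ToricExit.jordanThree_hasResolution_of_bricks` (p496627), discharged by
res-D-pv-033 AS res-L1-w45c-stub-5; [OURS · L1 W4.5c] — NOT a statement of any manuscript.)

Generic-point-FREE route (the in-kernel `genericPoint` computation on a `Proj` scheme is what
res-L1-w45c-lead-1 bisected as the kernel time-out of p496627's first version):

* `BlowupExit.nonempty_iInf_preimage_of_irreducibleSpace` — in an irreducible scheme a finite
  family of translates `f_g⁻¹ U` of a non-empty open `U` by surjective endomorphisms has non-empty
  intersection (`isIrreducible_iff_sInter`).
* `BlowupExit.affineBlowup_isPrincipalChart_chartOpen`, `BlowupExit.affineBlowup_chartOpen_le_blowupChart`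
  — for `Bl_I(Spec R)` and `b ∈ I` the Rees chart `D₊(bt)` is a principal chart of `π` for
  `(⊤, b)`, hence lies in the principal chart `Bl[⊤, b]` (Literature `blowupChart`); with
  `BlowupExit.affineBlowup_chartOpen_nonempty` (`D₊(bt) ≠ ∅` as soon as the chart ring
  `(R[It])_{(bt)}` is non-trivial) this makes `Bl[⊤, b]` non-empty.
* `ToricExit.nonempty_iInf_preimage_blowupChart_centre_b` — VERBATIM the hypothesis `HneOb` of
  p496627: for `V = Bl_{(x_a,x_b²)} 𝔸ⁿ` (integral, `ToricExit.centre_blowup_integral_proper_birational`)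
  and the lifted action of the finite group `⟨σ⟩`, `⋂_g g⁻¹ V[⊤, x_b²] ≠ ∅`.
-/

-- single-problem summit: the doubled namespace component `ResolutionOfSingularities` is forced
set_option linter.dupNamespace false

noncomputable section

open CategoryTheory AlgebraicGeometry TopologicalSpace MvPolynomial HomogeneousLocalization
open Literature.AlgebraicGeometry.Resolution

namespace Summit.ResolutionOfSingularities.ResolutionOfSingularities.Theorems.WildQuotientResolution

namespace BlowupExit

universe u

/-- **In an irreducible scheme, finitely many translates of a non-empty open by surjective
endomorphisms have non-empty intersection** (a non-empty open of an irreducible space is dense;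
`isIrreducible_iff_sInter`). [folklore] -/
theorem nonempty_iInf_preimage_of_irreducibleSpace {X : Scheme.{u}} [IrreducibleSpace X]
    {G : Type*} [Finite G] (f : G → (X ⟶ X)) (hf : ∀ g, Function.Surjective (f g).base)
    (U : X.Opens) (hU : (U : Set X).Nonempty) :
    ((⨅ g, (f g) ⁻¹ᵁ U : X.Opens) : Set X).Nonempty := by
  classical
  haveI : Fintype G := Fintype.ofFinite G
  rw [Opens.coe_iInf]
  have key := isIrreducible_iff_sInter.mp (IrreducibleSpace.isIrreducible_univ X)
    (Finset.univ.image fun g => (((f g) ⁻¹ᵁ U : X.Opens) : Set X)) ?_ ?_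
  · obtain ⟨x, -, hx⟩ := key
    refine ⟨x, Set.mem_iInter.mpr fun g => ?_⟩
    exact hx _ (Finset.mem_coe.mpr (Finset.mem_image_of_mem _ (Finset.mem_univ g)))
  · intro u hu
    obtain ⟨g, -, rfl⟩ := Finset.mem_image.mp hu
    exact ((f g) ⁻¹ᵁ U).isOpen
  · intro u hu
    obtain ⟨g, -, rfl⟩ := Finset.mem_image.mp hu
    rw [Set.univ_inter]
    exact hU.preimage (hf g)

variable {R : Type u} [CommRing R] {I : Ideal R}

/-- **The Rees chart `D₊(bt)` of `Bl_I(Spec R)` is a principal chart of `π` for `(⊤, b)`**: on it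
the pulled-back `b` is a non-zero-divisor generating the exceptional ideal
(`affineBlowup.pull_mem_nonZeroDivisors`, `affineBlowup.ideal_exceptionalIdeal_chartOpen`).
[cite: StacksProject, Tag 02OS (proof, via Tag 07Z3)] -/
theorem affineBlowup_isPrincipalChart_chartOpen (b : R) (hb : b ∈ I) :
    IsPrincipalChart (affineBlowup.π I) (affineBlowup.idealSheaf I) ⟨⊤, isAffineOpen_top _⟩
      ((Scheme.ΓSpecIso (.of R)).inv b) (affineBlowup.chartOpen b hb) := by
  refine ⟨by rw [Scheme.Hom.preimage_top]; exact le_top, ?_, ?_⟩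
  · exact affineBlowup.pull_mem_nonZeroDivisors b hb
  · exact affineBlowup.ideal_exceptionalIdeal_chartOpen b hb

/-- **`D₊(bt) ⊆ Bl[⊤, b]`**: the Rees chart lies in the principal chart of Literature
`blowupChart`. [cite: StacksProject, Tag 0804] -/
theorem affineBlowup_chartOpen_le_blowupChart (b : R) (hb : b ∈ I) :
    (affineBlowup.chartOpen b hb : (affineBlowup I).Opens) ≤
      blowupChart (affineBlowup.π I) (affineBlowup.idealSheaf I) ⟨⊤, isAffineOpen_top _⟩
        ((Scheme.ΓSpecIso (.of R)).inv b) :=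
  (affineBlowup_isPrincipalChart_chartOpen b hb).le_blowupChart

/-- **`D₊(bt) ≠ ∅` when the chart ring `(R[It])_{(bt)}` is non-trivial** (it is the range of the
open immersion `Spec (R[It])_{(bt)} → Bl_I(Spec R)`). [folklore] -/
theorem affineBlowup_chartOpen_nonempty (b : R) (hb : b ∈ I)
    [Nontrivial (Away (reesGrading I) (reesT b hb))] :
    ((affineBlowup.chartOpen b hb : (affineBlowup I).Opens) : Set (affineBlowup I)).Nonempty := by
  obtain ⟨m, hm⟩ := Ideal.exists_maximal (Away (reesGrading I) (reesT b hb))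
  let w : Spec (CommRingCat.of (Away (reesGrading I) (reesT b hb))) := ⟨m, hm.isPrime⟩
  refine ⟨(affineBlowup.chartι (I := I) b hb).base w, ?_⟩
  change (affineBlowup.chartι (I := I) b hb).base w ∈ affineBlowup.chartι (I := I) b hb ''ᵁ ⊤
  exact ⟨w, trivial, rfl⟩

/-- **`Bl[⊤, b] ≠ ∅` when the chart ring `(R[It])_{(bt)}` is non-trivial.** [folklore] -/
theorem affineBlowup_blowupChart_nonempty (b : R) (hb : b ∈ I)
    [Nontrivial (Away (reesGrading I) (reesT b hb))] :
    ((blowupChart (affineBlowup.π I) (affineBlowup.idealSheaf I) ⟨⊤, isAffineOpen_top _⟩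
        ((Scheme.ΓSpecIso (.of R)).inv b) : (affineBlowup I).Opens) :
          Set (affineBlowup I)).Nonempty :=
  (affineBlowup_chartOpen_nonempty b hb).mono (affineBlowup_chartOpen_le_blowupChart b hb)

/-- **The chart ring `(R[It])_{(bt)}` is non-trivial for `b` a non-zero element of a domain**
(it is `R[I/b] ⊆ R[1/b]`, `reesChartEquiv`). [folklore] -/
theorem nontrivial_away_reesT_of_ne_zero [IsDomain R] (b : R) (hb : b ∈ I) (hb0 : b ≠ 0) :
    Nontrivial (Away (reesGrading I) (reesT b hb)) := by
  haveI : IsDomain (Localization.Away b) :=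
    IsLocalization.isDomain_localization (powers_le_nonZeroDivisors_of_noZeroDivisors hb0)
  haveI : Nontrivial (blowupAlgebra I b) := inferInstance
  exact (reesChartEquiv b hb).toEquiv.nontrivial

end BlowupExit

namespace ToricExit

/-- **Brick `HneOb` of the J₃ toric exit** (hypothesis `HneOb` of
`ToricExit.jordanThree_hasResolution_of_bricks`, p496627, literally): for `V = Bl_{(x_a,x_b²)} 𝔸ⁿ`
with the lifted action of the finite group `⟨σ⟩`, the stable piece `⋂_g g⁻¹ V[⊤, x_b²]` is
non-empty (`V` is irreducible and `V[⊤, x_b²] ⊇ D₊(x_b² t) ≠ ∅`). [OURS · L1 W4.5c]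
[folklore; assembly of landed decls] -/
theorem nonempty_iInf_preimage_blowupChart_centre_b (k : Type) [Field k] (n : ℕ)
    (σ : MvPolynomial (Fin n) k ≃ₐ[k] MvPolynomial (Fin n) k) [Finite ↥(Subgroup.zpowers σ)]
    (a b c : Fin n) (hab : a ≠ b) (hac : a ≠ c)
    (hb : σ (X b) = X b + X a) (hσ : ∀ i, i ≠ b → i ≠ c → σ (X i) = X i)
    (ρ : ↥(Subgroup.zpowers σ) →* Aut (Spec (CommRingCat.of (MvPolynomial (Fin n) k))))
    (hρ : ∀ g : ↥(Subgroup.zpowers σ), (ρ g).hom = Spec.map (CommRingCat.ofHom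
      ((MulSemiringAction.toRingEquiv (↥(Subgroup.zpowers σ)) (MvPolynomial (Fin n) k) g⁻¹ :
        MvPolynomial (Fin n) k ≃+* MvPolynomial (Fin n) k) :
          MvPolynomial (Fin n) k →+* MvPolynomial (Fin n) k))) :
    (((⨅ g : ↥(Subgroup.zpowers σ),
        (((affineBlowup.isBlowup (Ideal.span (Set.range (![X a, X b ^ 2] :
          Fin 2 → MvPolynomial (Fin n) k)))).liftAction ρ
          (idealSheaf_centre_comap k n σ a b c hab hac hb hσ ρ hρ)) g).hom ⁻¹ᵁ
        blowupChart
          (affineBlowup.π (Ideal.span (Set.range (![X a, X b ^ 2] :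
            Fin 2 → MvPolynomial (Fin n) k))))
          (affineBlowup.idealSheaf (Ideal.span (Set.range (![X a, X b ^ 2] :
            Fin 2 → MvPolynomial (Fin n) k))))
          ⟨⊤, isAffineOpen_top _⟩
          ((Scheme.ΓSpecIso (CommRingCat.of (MvPolynomial (Fin n) k))).inv.hom (X b ^ 2)) :
        (affineBlowup (Ideal.span (Set.range (![X a, X b ^ 2] :
          Fin 2 → MvPolynomial (Fin n) k)))).Opens)) :
      Set (affineBlowup (Ideal.span (Set.range (![X a, X b ^ 2] :
        Fin 2 → MvPolynomial (Fin n) k))))).Nonempty := by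
  -- `V` is integral, hence irreducible
  haveI : IsIntegral (affineBlowup (Ideal.span (Set.range (![X a, X b ^ 2] :
      Fin 2 → MvPolynomial (Fin n) k)))) := (centre_blowup_integral_proper_birational k n a b).1
  -- the chart ring at `x_b²` is non-trivial (`x_b² ≠ 0` in the domain `k[x]`)
  have hxb : (X b ^ 2 : MvPolynomial (Fin n) k) ∈
      Ideal.span (Set.range (![X a, X b ^ 2] : Fin 2 → MvPolynomial (Fin n) k)) :=
    Ideal.subset_span ⟨1, rfl⟩
  haveI := BlowupExit.nontrivial_away_reesT_of_ne_zero (X b ^ 2 : MvPolynomial (Fin n) k) hxb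
    (pow_ne_zero 2 (X_ne_zero b))
  refine BlowupExit.nonempty_iInf_preimage_of_irreducibleSpace _ (fun g => ?_) _
    (BlowupExit.affineBlowup_blowupChart_nonempty (X b ^ 2 : MvPolynomial (Fin n) k) hxb)
  -- the translates are automorphisms, hence surjective
  intro v
  refine ⟨(((affineBlowup.isBlowup (Ideal.span (Set.range (![X a, X b ^ 2] :
      Fin 2 → MvPolynomial (Fin n) k)))).liftAction ρ
      (idealSheaf_centre_comap k n σ a b c hab hac hb hσ ρ hρ)) g).inv.base v, ?_⟩
  rw [← Scheme.Hom.comp_apply, Iso.inv_hom_id]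
  rfl

end ToricExit

end Summit.ResolutionOfSingularities.ResolutionOfSingularities.Theorems.WildQuotientResolution

end
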